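import Summits.QuantumFields.YangMills.Theorems.CoarseStiffnessTailCappedCoarseStiffnessLCommutatorChart
import Summits.QuantumFields.YangMills.Theorems.CoarseStiffnessTailCappedCoarseStiffnessLSlabGaussian
import Literature.MathematicalPhysics.QuantumFieldTheory.SU2OneLinkIntegrals

/-!
# Route `CoarseStiffnessTail` — THE COMMUTING-TRIPLE INTEGRAL ON `SU(2)³`, CORE ESTIMATES: Tonelli peeling, the central flip,
# the transversal Gaussian bound `ψ(e^{iA}) ≤ 3π³/(32 s|A|)` and the outer `|A|⁻²` integral
# (lead's certificate, seat `ym-line-cst-p1` g15; helper on 25301 `CappedCoarseStiffnessL`, stub S3 = uniform mean action, P2/(W2, core))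

THE ESTIMATES (assembled into `J(s) = ∫_{SU(2)³} exp(−s·Σ_{k<l}(1 − reTr[g_k,g_l])) dHaar³ ≤ C/s²` in `…LCommVolumeUpper`; `reTr = Re tr/2`):
* `lintegral_pi_three_eq` (TONELLI ON `α³`): `∫ ρ(x_m)Φ(x_m,x_a)Φ(x_m,x_b) dμ^{⊗3} = ∫ ρ(y)(∫Φ(y,·)dμ)² dμ(y)` for distinct `m,a,b`
  (Mathlib's `lmarginal`).
* `lintegral_le_two_mul_lintegral_pos` (HALVING): for `F` invariant under `g_k ↦ z g_k` with `reTr(z·) = −reTr`, Haar³-invariance of the flip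
  gives `∫F ≤ 2∫F·1[reTr g_k ≥ 0]`.
* `psi_expPauli_le` (THE CHART, [Balaban1985UV3] p.260: `dU = σ(|A|)d³A`, `σ ≤ 1/2π²`, `reTr e^{iA} = cos|A|`): for `0 < |A| ≤ π/2`,
  `ψ(e^{iA}) = ∫ 1[reTr e^{iA} ≤ reTr h]·e^{−s(1−reTr[e^{iA},h])} dh ≤ 3π³/(32 s|A|)` — since `cos|A| ≤ cos|X|, |X| < π ⇒ |X| ≤ |A|`, on the
  quarter ball `1 − reTr[e^{iA},e^{iX}] ≥ (32/π⁴)(|A|²|X|² − (A·X)²)` (`…LCommutatorChart`), and the slab Gaussian (`…LSlabGaussian`).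
* `lintegral_pos_psi_sq_le` (OUTER INTEGRAL): `ψ(e^{iA}) ≤ κ/(s|A|)` on `0 < |A| ≤ π/2` ⇒ `∫ 1[reTr y ≥ 0]ψ(y)² dy ≤ κ²/(2π²)·s⁻²·∫_{|A|<π}|A|⁻²d³A`
  (`|A|⁻²` integrable on balls of `ℝ³`: Mathlib `integrableOn_fun_norm_addHaar`).

HONEST SCOPE.  Haar-measure calculus on `SU(2)`; nothing of Bałaban's is asserted; the crux 25301, its stubs S1/S2/S3, `HistoryTailL` 19936
stay OPEN; `YM3TorusSU2` (R3, RECORD rung, not Clay) is NOT proved; the Yang–Mills mass gap is NOT touched.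

References: T. Bałaban, CMP **102** (1985) 255–275 [Balaban1985UV3] (p.260, `σ(A)dA`); I. Montvay, G. Münster, *Quantum Fields on a Lattice*
(1994) §3.2.3 [MontvayMunster1994]; [folklore] (almost-commuting tuples in compact groups).
-/

noncomputable section

open MeasureTheory Real
open scoped ENNReal BigOperators

namespace Summit.QuantumFields.YangMills.Theorems.CoarseStiffnessTailCommVolumeUpperCore

open Literature.MathematicalPhysics.QuantumFieldTheory (haarProbability)
open Literature.MathematicalPhysics.QuantumFieldTheory.Balaban1983to89
open Literature.MathematicalPhysics.QuantumFieldTheory.Balaban1983to89.B10Eq22Rescaling (sigmaSU2)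
open Literature.MathematicalPhysics.QuantumFieldTheory.Balaban1983to89.B10Eq18SigmaSU2Haar (expPauli coe_expPauli
  lintegral_haarProbability_eq_pauli ofReal_sigmaSU2_norm measurable_expPauli)
open Literature.MathematicalPhysics.QuantumFieldTheory.SU2OneLink (re_trace_expPauli_eq)
open Summit.QuantumFields.YangMills.Theorems.CoarseStiffnessTailCommutatorChart (one_sub_reTr_comm_ge_on_quarter quartic_nonneg)
open Summit.QuantumFields.YangMills.Theorems.CoarseStiffnessTailSlabGaussian (lintegral_closedBall_exp_quartic_le)

/-! ## §0 The class angle of the chart -/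

section Algebra

/-- `reTr(e^{iA}) = cos‖A‖` (normalised trace). [cite: MontvayMunster1994, §3.2.3 (3.96) p.121] -/
theorem reTr_expPauli (A : EuclideanSpace ℝ (Fin 3)) : reTr (expPauli A) = Real.cos ‖A‖ := by
  rw [B16ZLower.reTr_specialUnitaryGroup, UnitaryModel.nReTr, re_trace_expPauli_eq, Fintype.card_fin]
  push_cast
  ring

end Algebra

/-! ## §1 Tonelli on `α³`: integrating out the two partners of a distinguished coordinate -/

section Peel

/-- **PEELING ON `α³`**: for distinct `m, a, b : Fin 3`,
`∫ ρ(x_m)·Φ(x_m,x_a)·Φ(x_m,x_b) dμ^{⊗3} = ∫ ρ(y)·(∫Φ(y,z)dμ(z))² dμ(y)`. [folklore] -/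
theorem lintegral_pi_three_eq {α : Type*} [MeasurableSpace α] [Nonempty α] (μ : Measure α) [SigmaFinite μ]
    (ρ : α → ℝ≥0∞) (Φ : α → α → ℝ≥0∞) (hρ : Measurable ρ) (hΦ : Measurable (Function.uncurry Φ))
    (m a b : Fin 3) (hma : m ≠ a) (hmb : m ≠ b) (hab : a ≠ b) :
    ∫⁻ x, ρ (x m) * (Φ (x m) (x a) * Φ (x m) (x b)) ∂Measure.pi (fun _ : Fin 3 => μ) =
      ∫⁻ y, ρ y * ((∫⁻ z, Φ y z ∂μ) * ∫⁻ z, Φ y z ∂μ) ∂μ := by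
  classical
  have hΦ₂ : ∀ i j : Fin 3, Measurable fun x : Fin 3 → α => Φ (x i) (x j) := by
    intro i j
    have h := hΦ.comp ((measurable_pi_apply (X := fun _ : Fin 3 => α) i).prodMk
      (measurable_pi_apply (X := fun _ : Fin 3 => α) j))
    exact h
  have hψm : Measurable fun y => ∫⁻ z, Φ y z ∂μ := hΦ.lintegral_prod_right
  have hmF : Measurable fun x : Fin 3 → α => ρ (x m) * (Φ (x m) (x a) * Φ (x m) (x b)) :=
    (hρ.comp (measurable_pi_apply m)).mul ((hΦ₂ m a).mul (hΦ₂ m b))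
  have hmF₁ : Measurable fun x : Fin 3 → α => ρ (x m) * Φ (x m) (x b) * ∫⁻ z, Φ (x m) z ∂μ :=
    ((hρ.comp (measurable_pi_apply m)).mul (hΦ₂ m b)).mul (hψm.comp (measurable_pi_apply m))
  rw [lintegral_eq_lmarginal_univ (fun _ : Fin 3 => (‹Nonempty α›).some)]
  have ha' : a ∉ insert b ({m} : Finset (Fin 3)) := by simp [hab, hma.symm]
  have hb' : b ∉ ({m} : Finset (Fin 3)) := by simp [hmb.symm]
  have huniv : insert a (insert b ({m} : Finset (Fin 3))) = Finset.univ := by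
    apply Finset.eq_univ_of_card
    rw [Finset.card_insert_of_notMem ha', Finset.card_insert_of_notMem hb', Finset.card_singleton, Fintype.card_fin]
  rw [← huniv, lmarginal_insert' _ hmF ha']
  -- peel `a`
  have hstep₁ : (fun x : Fin 3 → α => ∫⁻ y, ρ ((Function.update x a y) m) *
      (Φ ((Function.update x a y) m) ((Function.update x a y) a) * Φ ((Function.update x a y) m) ((Function.update x a y) b)) ∂μ) =
      fun x => ρ (x m) * Φ (x m) (x b) * ∫⁻ z, Φ (x m) z ∂μ := by
    funext x
    simp only [Function.update_self, Function.update_of_ne hma, Function.update_of_ne (Ne.symm hab)]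
    have h1 : ∀ y, ρ (x m) * (Φ (x m) y * Φ (x m) (x b)) = ρ (x m) * Φ (x m) (x b) * Φ (x m) y := fun y => by ring
    simp_rw [h1]
    have hm1 : Measurable (fun y => Φ (x m) y) := hΦ.comp (measurable_prodMk_left : Measurable (Prod.mk (x m) : α → α × α))
    rw [lintegral_const_mul _ hm1]
  rw [hstep₁, lmarginal_insert' _ hmF₁ hb']
  -- peel `b`
  have hstep₂ : (fun x : Fin 3 → α => ∫⁻ y, ρ ((Function.update x b y) m) * Φ ((Function.update x b y) m) ((Function.update x b y) b) *
      ∫⁻ z, Φ ((Function.update x b y) m) z ∂μ ∂μ) =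
      fun x => ρ (x m) * ((∫⁻ z, Φ (x m) z ∂μ) * ∫⁻ z, Φ (x m) z ∂μ) := by
    funext x
    simp only [Function.update_self, Function.update_of_ne hmb]
    have h1 : ∀ y, ρ (x m) * Φ (x m) y * (∫⁻ z, Φ (x m) z ∂μ) = ρ (x m) * (∫⁻ z, Φ (x m) z ∂μ) * Φ (x m) y :=
      fun y => by ring
    simp_rw [h1]
    have hm1 : Measurable (fun y => Φ (x m) y) := hΦ.comp (measurable_prodMk_left : Measurable (Prod.mk (x m) : α → α × α))
    rw [lintegral_const_mul _ hm1]
    ring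
  rw [hstep₂, lmarginal_singleton]
  simp only [Function.update_self]

end Peel

/-! ## §2 Symmetrisation under the central flips `g_k ↦ −g_k` -/

section Flip

/-- **HALVING**: if `F ≥ 0` on `SU(2)³` is invariant under `g_k ↦ z g_k` for a trace-flipping `z`, then
`∫ F dHaar³ ≤ 2·∫ F·1[reTr g_k ≥ 0] dHaar³`. [folklore] -/
theorem lintegral_le_two_mul_lintegral_pos (z : Matrix.specialUnitaryGroup (Fin 2) ℂ)
    (hz : ∀ x, reTr (z * x) = -reTr x) (k : Fin 3)
    (F : (Fin 3 → Matrix.specialUnitaryGroup (Fin 2) ℂ) → ℝ≥0∞) (hF : Measurable F)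
    (hinv : ∀ g, F (Function.update (1 : Fin 3 → Matrix.specialUnitaryGroup (Fin 2) ℂ) k z * g) = F g) :
    ∫⁻ g, F g ∂Measure.pi (fun _ : Fin 3 => haarProbability (Matrix.specialUnitaryGroup (Fin 2) ℂ)) ≤
      2 * ∫⁻ g, F g * {g : Fin 3 → Matrix.specialUnitaryGroup (Fin 2) ℂ | 0 ≤ reTr (g k)}.indicator 1 g
        ∂Measure.pi (fun _ : Fin 3 => haarProbability (Matrix.specialUnitaryGroup (Fin 2) ℂ)) := by
  classical
  haveI : Measure.IsHaarMeasure (haarProbability (Matrix.specialUnitaryGroup (Fin 2) ℂ)) := by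
    unfold haarProbability; infer_instance
  haveI : IsProbabilityMeasure (haarProbability (Matrix.specialUnitaryGroup (Fin 2) ℂ)) :=
    HaarData.isProb (G := Matrix.specialUnitaryGroup (Fin 2) ℂ)
  have hS : MeasurableSet {g : Fin 3 → Matrix.specialUnitaryGroup (Fin 2) ℂ | 0 ≤ reTr (g k)} :=
    measurableSet_le measurable_const (RegularGaugeGroup.measurable_reTr.comp (measurable_pi_apply k))
  have hsplit : ∀ g, F g = F g * {g : Fin 3 → Matrix.specialUnitaryGroup (Fin 2) ℂ | 0 ≤ reTr (g k)}.indicator 1 g +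
      F g * {g : Fin 3 → Matrix.specialUnitaryGroup (Fin 2) ℂ | 0 ≤ reTr (g k)}ᶜ.indicator 1 g := by
    intro g
    by_cases hg : g ∈ {g : Fin 3 → Matrix.specialUnitaryGroup (Fin 2) ℂ | 0 ≤ reTr (g k)}
    · rw [Set.indicator_of_mem hg, Set.indicator_of_notMem (Set.notMem_compl_iff.2 hg)]; simp
    · rw [Set.indicator_of_notMem hg, Set.indicator_of_mem (Set.mem_compl hg)]; simp
  have h2 : ∫⁻ g, F g * {g : Fin 3 → Matrix.specialUnitaryGroup (Fin 2) ℂ | 0 ≤ reTr (g k)}ᶜ.indicator 1 g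
        ∂Measure.pi (fun _ : Fin 3 => haarProbability (Matrix.specialUnitaryGroup (Fin 2) ℂ)) ≤
      ∫⁻ g, F g * {g : Fin 3 → Matrix.specialUnitaryGroup (Fin 2) ℂ | 0 ≤ reTr (g k)}.indicator 1 g
        ∂Measure.pi (fun _ : Fin 3 => haarProbability (Matrix.specialUnitaryGroup (Fin 2) ℂ)) := by
    rw [← lintegral_mul_left_eq_self
      (fun g => F g * {g : Fin 3 → Matrix.specialUnitaryGroup (Fin 2) ℂ | 0 ≤ reTr (g k)}ᶜ.indicator 1 g)
      (Function.update (1 : Fin 3 → Matrix.specialUnitaryGroup (Fin 2) ℂ) k z)]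
    refine lintegral_mono fun g => ?_
    simp only
    rw [hinv g]
    refine mul_le_mul' le_rfl ?_
    by_cases hg : Function.update (1 : Fin 3 → Matrix.specialUnitaryGroup (Fin 2) ℂ) k z * g ∈
        {g : Fin 3 → Matrix.specialUnitaryGroup (Fin 2) ℂ | 0 ≤ reTr (g k)}ᶜ
    · have hg' : g ∈ {g : Fin 3 → Matrix.specialUnitaryGroup (Fin 2) ℂ | 0 ≤ reTr (g k)} := by
        simp only [Set.mem_compl_iff, Set.mem_setOf_eq, Pi.mul_apply, Function.update_self, hz, not_le] at hg
        exact (neg_lt_zero.1 hg).le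
      rw [Set.indicator_of_mem hg, Set.indicator_of_mem hg']
      exact le_rfl
    · rw [Set.indicator_of_notMem hg]; exact bot_le
  calc ∫⁻ g, F g ∂Measure.pi (fun _ : Fin 3 => haarProbability (Matrix.specialUnitaryGroup (Fin 2) ℂ))
      = ∫⁻ g, (F g * {g : Fin 3 → Matrix.specialUnitaryGroup (Fin 2) ℂ | 0 ≤ reTr (g k)}.indicator 1 g +
          F g * {g : Fin 3 → Matrix.specialUnitaryGroup (Fin 2) ℂ | 0 ≤ reTr (g k)}ᶜ.indicator 1 g)
          ∂Measure.pi (fun _ : Fin 3 => haarProbability (Matrix.specialUnitaryGroup (Fin 2) ℂ)) :=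
        lintegral_congr fun g => hsplit g
    _ = (∫⁻ g, F g * {g : Fin 3 → Matrix.specialUnitaryGroup (Fin 2) ℂ | 0 ≤ reTr (g k)}.indicator 1 g
          ∂Measure.pi (fun _ : Fin 3 => haarProbability (Matrix.specialUnitaryGroup (Fin 2) ℂ))) +
        ∫⁻ g, F g * {g : Fin 3 → Matrix.specialUnitaryGroup (Fin 2) ℂ | 0 ≤ reTr (g k)}ᶜ.indicator 1 g
          ∂Measure.pi (fun _ : Fin 3 => haarProbability (Matrix.specialUnitaryGroup (Fin 2) ℂ)) :=
        lintegral_add_left (hF.mul (measurable_one.indicator hS)) _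
    _ ≤ (∫⁻ g, F g * {g : Fin 3 → Matrix.specialUnitaryGroup (Fin 2) ℂ | 0 ≤ reTr (g k)}.indicator 1 g
          ∂Measure.pi (fun _ : Fin 3 => haarProbability (Matrix.specialUnitaryGroup (Fin 2) ℂ))) +
        ∫⁻ g, F g * {g : Fin 3 → Matrix.specialUnitaryGroup (Fin 2) ℂ | 0 ≤ reTr (g k)}.indicator 1 g
          ∂Measure.pi (fun _ : Fin 3 => haarProbability (Matrix.specialUnitaryGroup (Fin 2) ℂ)) :=
        add_le_add le_rfl h2
    _ = 2 * ∫⁻ g, F g * {g : Fin 3 → Matrix.specialUnitaryGroup (Fin 2) ℂ | 0 ≤ reTr (g k)}.indicator 1 g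
          ∂Measure.pi (fun _ : Fin 3 => haarProbability (Matrix.specialUnitaryGroup (Fin 2) ℂ)) := by rw [two_mul]

end Flip

/-! ## §3 The chart: the transversal Gaussian bound on `ψ` and the outer `‖A‖⁻²` integral -/

section Chart

/-- `σ_{SU(2)}(|A|) ≤ 1/(2π²)` (`sinc² ≤ 1`). [cite: Balaban1985UV3, p.260] -/
theorem ofReal_sigmaSU2_le (A : EuclideanSpace ℝ (Fin 3)) :
    ENNReal.ofReal (sigmaSU2 ‖A‖) ≤ ENNReal.ofReal (1 / (2 * π ^ 2)) := by
  rw [ofReal_sigmaSU2_norm]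
  have h1 : ENNReal.ofReal (Real.sinc ‖A‖ ^ 2) ≤ 1 := by
    refine ENNReal.ofReal_le_one.2 ?_
    have h := Real.abs_sinc_le_one ‖A‖
    calc Real.sinc ‖A‖ ^ 2 = |Real.sinc ‖A‖| ^ 2 := (sq_abs _).symm
      _ ≤ 1 ^ 2 := pow_le_pow_left₀ (abs_nonneg _) h 2
      _ = 1 := one_pow 2
  calc ENNReal.ofReal (1 / (2 * π ^ 2)) * ENNReal.ofReal (Real.sinc ‖A‖ ^ 2)
      ≤ ENNReal.ofReal (1 / (2 * π ^ 2)) * 1 := mul_le_mul' le_rfl h1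
    _ = ENNReal.ofReal (1 / (2 * π ^ 2)) := mul_one _

/-- In the chart: `cos‖A‖ ≤ cos‖X‖`, `‖X‖ < π` ⇒ `‖X‖ ≤ ‖A‖`. [folklore] -/
theorem norm_le_of_cos_le {A X : EuclideanSpace ℝ (Fin 3)} (hX : ‖X‖ < π) (h : Real.cos ‖A‖ ≤ Real.cos ‖X‖) :
    ‖X‖ ≤ ‖A‖ := by
  by_contra hlt
  push Not at hlt
  by_cases hAπ : ‖A‖ ≤ π
  · have := Real.strictAntiOn_cos ⟨norm_nonneg A, hAπ⟩ ⟨norm_nonneg X, hX.le⟩ hlt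
    linarith
  · push Not at hAπ
    linarith

/-- In the chart: `0 ≤ cos‖A‖`, `‖A‖ < π` ⇒ `‖A‖ ≤ π/2`. [folklore] -/
theorem norm_le_pi_div_two_of_cos_nonneg {A : EuclideanSpace ℝ (Fin 3)} (hA : ‖A‖ < π) (h : 0 ≤ Real.cos ‖A‖) :
    ‖A‖ ≤ π / 2 := by
  by_contra hlt
  push Not at hlt
  have := Real.strictAntiOn_cos ⟨by positivity, by linarith [Real.pi_pos]⟩ ⟨norm_nonneg A, hA.le⟩ hlt
  rw [Real.cos_pi_div_two] at this
  linarith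

/-- **THE TRANSVERSAL GAUSSIAN BOUND ON `ψ`** (`s > 0`, `0 < ‖A‖ ≤ π/2`):
`ψ(e^{iA}) = ∫ 1[reTr e^{iA} ≤ reTr h]·e^{−s(1−reTr[e^{iA},h])} dh ≤ 3π³/(32·s‖A‖)`. [folklore] -/
theorem psi_expPauli_le {s : ℝ} (hs : 0 < s) (A : EuclideanSpace ℝ (Fin 3)) (hA : ‖A‖ ≤ π / 2) (hA0 : A ≠ 0) :
    ∫⁻ h, {h : Matrix.specialUnitaryGroup (Fin 2) ℂ | reTr (expPauli A) ≤ reTr h}.indicator 1 h *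
        ENNReal.ofReal (Real.exp (-(s * (1 - reTr (expPauli A * h * (expPauli A)⁻¹ * h⁻¹)))))
        ∂haarProbability (Matrix.specialUnitaryGroup (Fin 2) ℂ) ≤
      ENNReal.ofReal (3 * π ^ 3 / 32 / (s * ‖A‖)) := by
  have hAn : ‖A‖ ≠ 0 := (norm_pos_iff.2 hA0).ne'
  have hmeas : Measurable fun h : Matrix.specialUnitaryGroup (Fin 2) ℂ =>
      {h : Matrix.specialUnitaryGroup (Fin 2) ℂ | reTr (expPauli A) ≤ reTr h}.indicator 1 h *
        ENNReal.ofReal (Real.exp (-(s * (1 - reTr (expPauli A * h * (expPauli A)⁻¹ * h⁻¹))))) := by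
    refine (measurable_one.indicator (measurableSet_le measurable_const RegularGaugeGroup.measurable_reTr)).mul ?_
    refine (Measurable.exp (Measurable.neg (Measurable.const_mul (measurable_const.sub
      (RegularGaugeGroup.measurable_reTr.comp ?_)) s))).ennreal_ofReal
    exact ((measurable_const.mul measurable_id).mul measurable_const).mul measurable_id.inv
  rw [lintegral_haarProbability_eq_pauli _ hmeas]
  -- the rate of the quartic after the quarter-ball bound
  obtain ⟨t, ht⟩ : ∃ t : ℝ, t = 32 / π ^ 4 * s := ⟨_, rfl⟩
  have ht0 : 0 < t := by rw [ht]; positivity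
  have hKm : Measurable fun X : EuclideanSpace ℝ (Fin 3) =>
      ENNReal.ofReal (Real.exp (-(t * (‖A‖ ^ 2 * ‖X‖ ^ 2 - inner ℝ A X ^ 2)))) := by
    have hc : Continuous fun X : EuclideanSpace ℝ (Fin 3) => Real.exp (-(t * (‖A‖ ^ 2 * ‖X‖ ^ 2 - inner ℝ A X ^ 2))) := by
      fun_prop
    exact hc.measurable.ennreal_ofReal
  -- pointwise bound on the chart ball
  have hpt : ∀ X ∈ Metric.ball (0 : EuclideanSpace ℝ (Fin 3)) π,
      {h : Matrix.specialUnitaryGroup (Fin 2) ℂ | reTr (expPauli A) ≤ reTr h}.indicator 1 (expPauli X) *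
          ENNReal.ofReal (Real.exp (-(s * (1 - reTr (expPauli A * expPauli X * (expPauli A)⁻¹ * (expPauli X)⁻¹))))) *
          ENNReal.ofReal (sigmaSU2 ‖X‖) ≤
        (Metric.closedBall (0 : EuclideanSpace ℝ (Fin 3)) ‖A‖).indicator
          (fun X => ENNReal.ofReal (Real.exp (-(t * (‖A‖ ^ 2 * ‖X‖ ^ 2 - inner ℝ A X ^ 2))))) X *
          ENNReal.ofReal (1 / (2 * π ^ 2)) := by
    intro X hX
    rw [Metric.mem_ball, dist_zero_right] at hX
    by_cases hle : reTr (expPauli A) ≤ reTr (expPauli X)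
    · have hXA : ‖X‖ ≤ ‖A‖ := by
        rw [reTr_expPauli, reTr_expPauli] at hle
        exact norm_le_of_cos_le hX hle
      have hmem : expPauli X ∈ {h : Matrix.specialUnitaryGroup (Fin 2) ℂ | reTr (expPauli A) ≤ reTr h} := hle
      have hXball : X ∈ Metric.closedBall (0 : EuclideanSpace ℝ (Fin 3)) ‖A‖ := by
        rw [Metric.mem_closedBall, dist_zero_right]; exact hXA
      rw [Set.indicator_of_mem hmem, Set.indicator_of_mem hXball, Pi.one_apply, one_mul]
      refine mul_le_mul' ?_ (ofReal_sigmaSU2_le X)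
      apply ENNReal.ofReal_le_ofReal
      apply Real.exp_le_exp.2
      have hq := one_sub_reTr_comm_ge_on_quarter (A := A) (B := X) hA (hXA.trans hA)
      have hK := quartic_nonneg A X
      have h1 : t * (‖A‖ ^ 2 * ‖X‖ ^ 2 - inner ℝ A X ^ 2) = s * (32 / π ^ 4 * (‖A‖ ^ 2 * ‖X‖ ^ 2 - inner ℝ A X ^ 2)) := by
        rw [ht]; ring
      rw [h1]
      have := mul_le_mul_of_nonneg_left hq hs.le
      linarith
    · have hnm : expPauli X ∉ {h : Matrix.specialUnitaryGroup (Fin 2) ℂ | reTr (expPauli A) ≤ reTr h} := hle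
      rw [Set.indicator_of_notMem hnm, zero_mul, zero_mul]
      exact bot_le
  calc ∫⁻ X in Metric.ball (0 : EuclideanSpace ℝ (Fin 3)) π,
        {h : Matrix.specialUnitaryGroup (Fin 2) ℂ | reTr (expPauli A) ≤ reTr h}.indicator 1 (expPauli X) *
          ENNReal.ofReal (Real.exp (-(s * (1 - reTr (expPauli A * expPauli X * (expPauli A)⁻¹ * (expPauli X)⁻¹))))) *
          ENNReal.ofReal (sigmaSU2 ‖X‖)
      ≤ ∫⁻ X in Metric.ball (0 : EuclideanSpace ℝ (Fin 3)) π,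
          (Metric.closedBall (0 : EuclideanSpace ℝ (Fin 3)) ‖A‖).indicator
            (fun X => ENNReal.ofReal (Real.exp (-(t * (‖A‖ ^ 2 * ‖X‖ ^ 2 - inner ℝ A X ^ 2))))) X *
          ENNReal.ofReal (1 / (2 * π ^ 2)) := setLIntegral_mono' measurableSet_ball hpt
    _ ≤ ∫⁻ X, (Metric.closedBall (0 : EuclideanSpace ℝ (Fin 3)) ‖A‖).indicator
            (fun X => ENNReal.ofReal (Real.exp (-(t * (‖A‖ ^ 2 * ‖X‖ ^ 2 - inner ℝ A X ^ 2))))) X *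
          ENNReal.ofReal (1 / (2 * π ^ 2)) := setLIntegral_le_lintegral _ _
    _ = (∫⁻ X in Metric.closedBall (0 : EuclideanSpace ℝ (Fin 3)) ‖A‖,
          ENNReal.ofReal (Real.exp (-(t * (‖A‖ ^ 2 * ‖X‖ ^ 2 - inner ℝ A X ^ 2))))) * ENNReal.ofReal (1 / (2 * π ^ 2)) := by
        rw [lintegral_mul_const _ (hKm.indicator measurableSet_closedBall), lintegral_indicator measurableSet_closedBall]
    _ ≤ ENNReal.ofReal (6 * π / (t * ‖A‖)) * ENNReal.ofReal (1 / (2 * π ^ 2)) :=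
        mul_le_mul' (lintegral_closedBall_exp_quartic_le A hA0 ht0) le_rfl
    _ = ENNReal.ofReal (3 * π ^ 3 / 32 / (s * ‖A‖)) := by
        rw [← ENNReal.ofReal_mul (by positivity)]
        congr 1
        rw [ht]
        field_simp
        ring

/-- **THE OUTER INTEGRAL**: if `ψ(e^{iA}) ≤ κ/(s‖A‖)` on `0 < ‖A‖ ≤ π/2`, then
`∫ 1[reTr y ≥ 0]·ψ(y)² dHaar(y) ≤ κ²/(2π²)·s⁻²·∫_{|A|<π} ‖A‖⁻² d³A`. [folklore] -/
theorem lintegral_pos_psi_sq_le {s κ : ℝ} (hs : 0 < s) (hκ : 0 ≤ κ)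
    (ψ : Matrix.specialUnitaryGroup (Fin 2) ℂ → ℝ≥0∞) (hψm : Measurable ψ)
    (hψ : ∀ A : EuclideanSpace ℝ (Fin 3), ‖A‖ ≤ π / 2 → A ≠ 0 → ψ (expPauli A) ≤ ENNReal.ofReal (κ / (s * ‖A‖))) :
    ∫⁻ y, {y : Matrix.specialUnitaryGroup (Fin 2) ℂ | 0 ≤ reTr y}.indicator 1 y * (ψ y * ψ y)
        ∂haarProbability (Matrix.specialUnitaryGroup (Fin 2) ℂ) ≤
      ENNReal.ofReal (κ ^ 2 / (2 * π ^ 2) / s ^ 2 *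
        ∫ A in Metric.ball (0 : EuclideanSpace ℝ (Fin 3)) π, (‖A‖ ^ 2)⁻¹) := by
  have hmeas : Measurable fun y : Matrix.specialUnitaryGroup (Fin 2) ℂ =>
      {y : Matrix.specialUnitaryGroup (Fin 2) ℂ | 0 ≤ reTr y}.indicator 1 y * (ψ y * ψ y) :=
    (measurable_one.indicator (measurableSet_le measurable_const RegularGaugeGroup.measurable_reTr)).mul (hψm.mul hψm)
  rw [lintegral_haarProbability_eq_pauli _ hmeas]
  -- `‖A‖⁻²` is integrable on the ball of `ℝ³`
  have hint : IntegrableOn (fun A : EuclideanSpace ℝ (Fin 3) => (‖A‖ ^ 2)⁻¹)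
      (Metric.ball (0 : EuclideanSpace ℝ (Fin 3)) π) volume := by
    refine (integrableOn_fun_norm_addHaar (volume : Measure (EuclideanSpace ℝ (Fin 3)))
      (f := fun y : ℝ => (y ^ 2)⁻¹) (r := π)).2 ?_
    rw [finrank_euclideanSpace_fin]
    have heq : Set.EqOn (fun y : ℝ => y ^ (3 - 1) • (y ^ 2)⁻¹) (fun _ => (1 : ℝ)) (Set.Ioo 0 π) := by
      intro y hy
      have hy0 : y ≠ 0 := hy.1.ne'
      simp only [smul_eq_mul]
      field_simp
    rw [integrableOn_congr_fun heq measurableSet_Ioo]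
    exact integrableOn_const (by rw [Real.volume_Ioo]; exact ENNReal.ofReal_ne_top)
  -- a.e. pointwise bound on the chart ball (off the null set `{0}`)
  have h0 : ∀ᵐ A ∂(volume.restrict (Metric.ball (0 : EuclideanSpace ℝ (Fin 3)) π)), A ≠ 0 := by
    apply ae_restrict_of_ae
    have hz : (volume : Measure (EuclideanSpace ℝ (Fin 3))) {0} = 0 := measure_singleton 0
    exact (measure_eq_zero_iff_ae_notMem.1 hz).mono fun A hA => by simpa using hA
  have hpt : ∀ᵐ A ∂(volume.restrict (Metric.ball (0 : EuclideanSpace ℝ (Fin 3)) π)),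
      {y : Matrix.specialUnitaryGroup (Fin 2) ℂ | 0 ≤ reTr y}.indicator 1 (expPauli A) *
          (ψ (expPauli A) * ψ (expPauli A)) * ENNReal.ofReal (sigmaSU2 ‖A‖) ≤
        (Metric.ball (0 : EuclideanSpace ℝ (Fin 3)) π).indicator
          (fun A => ENNReal.ofReal (κ ^ 2 / (2 * π ^ 2) / s ^ 2 * (‖A‖ ^ 2)⁻¹)) A := by
    filter_upwards [h0, ae_restrict_mem measurableSet_ball] with A hA0 hAball
    have hAπ : ‖A‖ < π := by rw [Metric.mem_ball, dist_zero_right] at hAball; exact hAball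
    by_cases hpos : 0 ≤ reTr (expPauli A)
    · have hAle : ‖A‖ ≤ π / 2 := by
        rw [reTr_expPauli] at hpos
        exact norm_le_pi_div_two_of_cos_nonneg hAπ hpos
      have hmem : expPauli A ∈ {y : Matrix.specialUnitaryGroup (Fin 2) ℂ | 0 ≤ reTr y} := hpos
      rw [Set.indicator_of_mem hmem, Set.indicator_of_mem hAball, Pi.one_apply, one_mul]
      have hb := hψ A hAle hA0
      have hAn : ‖A‖ ≠ 0 := (norm_pos_iff.2 hA0).ne'
      calc ψ (expPauli A) * ψ (expPauli A) * ENNReal.ofReal (sigmaSU2 ‖A‖)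
          ≤ ENNReal.ofReal (κ / (s * ‖A‖)) * ENNReal.ofReal (κ / (s * ‖A‖)) * ENNReal.ofReal (1 / (2 * π ^ 2)) :=
            mul_le_mul' (mul_le_mul' hb hb) (ofReal_sigmaSU2_le A)
        _ = ENNReal.ofReal (κ ^ 2 / (2 * π ^ 2) / s ^ 2 * (‖A‖ ^ 2)⁻¹) := by
            rw [← ENNReal.ofReal_mul (by positivity), ← ENNReal.ofReal_mul (by positivity)]
            congr 1
            field_simp
    · have hnm : expPauli A ∉ {y : Matrix.specialUnitaryGroup (Fin 2) ℂ | 0 ≤ reTr y} := hpos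
      rw [Set.indicator_of_notMem hnm, zero_mul, zero_mul]
      exact bot_le
  have hφm : Measurable fun A : EuclideanSpace ℝ (Fin 3) => ENNReal.ofReal (κ ^ 2 / (2 * π ^ 2) / s ^ 2 * (‖A‖ ^ 2)⁻¹) :=
    (measurable_const.mul (measurable_norm.pow_const 2).inv).ennreal_ofReal
  calc ∫⁻ A in Metric.ball (0 : EuclideanSpace ℝ (Fin 3)) π,
        {y : Matrix.specialUnitaryGroup (Fin 2) ℂ | 0 ≤ reTr y}.indicator 1 (expPauli A) *
          (ψ (expPauli A) * ψ (expPauli A)) * ENNReal.ofReal (sigmaSU2 ‖A‖)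
      ≤ ∫⁻ A in Metric.ball (0 : EuclideanSpace ℝ (Fin 3)) π, (Metric.ball (0 : EuclideanSpace ℝ (Fin 3)) π).indicator
          (fun A => ENNReal.ofReal (κ ^ 2 / (2 * π ^ 2) / s ^ 2 * (‖A‖ ^ 2)⁻¹)) A := lintegral_mono_ae hpt
    _ ≤ ∫⁻ A, (Metric.ball (0 : EuclideanSpace ℝ (Fin 3)) π).indicator
          (fun A => ENNReal.ofReal (κ ^ 2 / (2 * π ^ 2) / s ^ 2 * (‖A‖ ^ 2)⁻¹)) A := setLIntegral_le_lintegral _ _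
    _ = ∫⁻ A in Metric.ball (0 : EuclideanSpace ℝ (Fin 3)) π, ENNReal.ofReal (κ ^ 2 / (2 * π ^ 2) / s ^ 2 * (‖A‖ ^ 2)⁻¹) :=
        lintegral_indicator measurableSet_ball _
    _ = ENNReal.ofReal (κ ^ 2 / (2 * π ^ 2) / s ^ 2) *
          ∫⁻ A in Metric.ball (0 : EuclideanSpace ℝ (Fin 3)) π, ENNReal.ofReal ((‖A‖ ^ 2)⁻¹) := by
        rw [← lintegral_const_mul' _ _ ENNReal.ofReal_ne_top]
        refine lintegral_congr fun A => ?_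
        rw [← ENNReal.ofReal_mul (by positivity)]
    _ = ENNReal.ofReal (κ ^ 2 / (2 * π ^ 2) / s ^ 2) *
          ENNReal.ofReal (∫ A in Metric.ball (0 : EuclideanSpace ℝ (Fin 3)) π, (‖A‖ ^ 2)⁻¹) := by
        rw [ofReal_integral_eq_lintegral_ofReal hint (ae_of_all _ fun A => by positivity)]
    _ = ENNReal.ofReal (κ ^ 2 / (2 * π ^ 2) / s ^ 2 *
          ∫ A in Metric.ball (0 : EuclideanSpace ℝ (Fin 3)) π, (‖A‖ ^ 2)⁻¹) := (ENNReal.ofReal_mul (by positivity)).symm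

end Chart

end Summit.QuantumFields.YangMills.Theorems.CoarseStiffnessTailCommVolumeUpperCore

end
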